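import Literature.MathematicalPhysics.QuantumFieldTheory.Balaban1983to89.B15Prop1CritTransferOfGaugeRetraction
import Literature.MathematicalPhysics.QuantumFieldTheory.Balaban1983to89.B16Sect1Backgrounds
import Literature.MathematicalPhysics.QuantumFieldTheory.Balaban1983to89.B14Eq16FaddeevPopov

/-!
# `Balaban1983to89.B15Prop1GaugeRetractionOfGaugeSection` — [Balaban1985Variational] = «[15]», (4) p. 278, (16)–(18) p. 280, Thm 1 p. 279; [Balaban1985RegularSpaces] = «[6]»,
# (1.19) p. 79 (`Ax_k(𝔅_k, U₀)`); [Balaban1985Averaging] (11) p. 19 («Ū^u = (Ū)^u»), (21) p. 21; [Balaban1988Convergent] = «[III]», (0.2) p. 244, (2.10)–(2.12) p. 256: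
# THE GAUGE-RETRACTION LETTER `hπ` OF `B15Prop1CritTransferOfGaugeRetraction` FROM A RESIDUAL GAUGE-FIXING MAP — after this file the ONLY displayed datum of the N12
# criticality transfer is the `𝐁`-ADAPTED AXIAL GAUGE-FIXING MAP itself (four print-shaped clauses (σ1)–(σ4), [6] (1.19)); its degenerate instance `σ := 1` at the full slice
# inhabits `hπ` (A6 non-vacuity)

Honest framing: statement-level skeleton of published theorems with citation tags; proofs where landed; nothing here is a claim about the
Yang–Mills mass gap.  Cell `pub-ymgap`, HUMAN RULING D-0149 ∕ director-ym R399 (3a) (width seats), seat `pub-ymgap-dag-n12-w6` (g0; N12 = [B15]); `--kind proof --supports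
stmt-QuantumFields-20542`; count-neutral; N12 NOT discharged; finite 𝕋⁴ at fixed ε; nothing continuum ∕ ℝ⁴ ∕ OS ∕ mass-gap ∕ Clay.

WHY.  `B15Prop1CritTransferOfGaugeRetraction.hcritT_curve_of_gaugeRetraction` proves the criticality transfer `hcritT` of dag-n12-w1's local minimiser chart modulo ONE displayed
letter `hπ`: near `(0, ↑Q₀)`, every fibre curve `γ` through a slice-chart point `U′` is carried by a slice curve `X` (differentiable at `0`, `X 0 = w.1`) whose chart images are
`SU(2)` fields with the same Wilson action and still on the fibre.  Print supplies `hπ` by GAUGE FIXING ([15] p. 280: «Using the transformations (16) with u satisfying (4) we fix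
the axial gauge conditions Ax_k(𝔅_k, U₀) … The functional (5) is gauge invariant, hence it is enough to consider it on the space (18)»).  THIS FILE performs that reduction in the
kernel: from a gauge-fixing MAP `σ : U ↦ u(U)` with four print-shaped properties — (σ1) it does not move the slice chart (`σ (exp(X)·U₀) = 1` for `X ∈ S`), (σ2) it moves every
configuration INTO the slice chart in the logarithmic coordinates relative to `U₀` ([15] p. 307 «B = (1∕i) log V»), (σ3) it is differentiable along differentiable curves, (σ4) it is
RESIDUAL ((4): trivial at the block towers of the constrained bonds of `𝐁`) — the letter `hπ` follows, the action clause by gauge invariance of (5) (r11's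
`B14Eq16FaddeevPopov.wilsonAction4_gaugeAct'`) and the fibre clause by the gauge covariance of the iterated averaging (r13's `B16Sect1Backgrounds.iter_gaugeAct`, [Balaban1985Averaging]
(11)) killed at the constrained bonds by (σ4).  The slice curve is the logarithmic chart of the gauge-fixed curve (`B15SU2ChartHolomorphic.logCoordC`, inverse identities
`logCoordC_expPointC` ∕ `expPointC_logCoordC`), carried into the submodule `S` by a continuous linear projection (finite dimension).

CONTENTS (theorems only; no `def`, no `instance`, no `sorry`).  §1 small plumbing (`gaugeAct_apply_eq_of_trivial`, `agreeOn_gaugeAct_of_residual` — the residual group (4) preserves the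
fibre (3) —, `det_coe_mul_star_coe`, `logCoordC_coe_mul_star_of_expMulC_eq`, `expPointC_logCoordC_mul_coe` — chart∕log identities at `SU(2)` points).  §2 ★★★ `gaugeRetraction_of_gaugeSection` — (σ1)–(σ4) + `k ≤ m + K` + `𝐁` of levels `≤ k` ⟹ the letter `hπ` of `hcritT_curve_of_gaugeRetraction` VERBATIM.
§3 ★★ `hcritT_curve_of_gaugeSection` ∕ `hcritT_isCritOnFibre_of_gaugeSection` — the composition: w1's `hcritT` binder at curve-criticality (resp. n07-e's `Node00.IsCritOnFibre` at the
record) from the base-field data and (σ1)–(σ4).  §4 ★ `gaugeRetraction_top` — NON-VACUITY: at the full slice `S = ⊤` the trivial gauge `σ := 1` satisfies (σ1)–(σ4), so `hπ` holds there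
outright (the degenerate witness; on `⊤` the companion letter (β) of the chart fails — the honest instance is the axial gauge of [6] (1.19), dag-n12-w3's `hierAxial` objects).

HONEST FRAMING: kernel bookkeeping (chain rule, logarithmic chart, gauge covariance); nothing of Bałaban's asserted; the axial gauge-fixing map for a genuine gauge slice stays
displayed ((σ1)–(σ4)); (E) and `hT1u` stay displayed in the lane; N12 NOT discharged; K1⁷ NOT closed; counts unmoved; one finite 𝕋⁴ programme at fixed ε — NOT continuum ∕ ℝ⁴ ∕
OS ∕ mass gap ∕ Clay.
-/

noncomputable section

namespace Literature.MathematicalPhysics.QuantumFieldTheory.Balaban1983to89.B15Prop1GaugeRetractionOfGaugeSection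

open Set Metric Filter
open scoped Topology
open Literature.MathematicalPhysics.QuantumFieldTheory.Balaban1983to89.Node00 (SU coeField coeField_apply SmallBelow ConstrSet constrCard constrEnum IsCritOnFibre
  avOfRecord star_coe_mul_coe_SU coe_mul_star_coe_SU)
open B15AveragingHolomorphic (iterMh)
open B15SU2ChartHolomorphic (genE expPointC expMulC logCoordC logCoordC_expPointC expPointC_logCoordC differentiableAt_logCoordC det_expPointC)
open B15Prop1DatumCoordinates (expMulC_zero_left)
open B15Prop1CritTransferOfGaugeRetraction (hcritT_curve_of_gaugeRetraction hcritT_isCritOnFibre_of_gaugeRetraction)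
open B16Sect1Backgrounds (toMS iter_gaugeAct)
open B14Eq16FaddeevPopov (wilsonAction4_gaugeAct')
open ExpMeanLog (expMeanLogSU)
open BlockAveraging (blockAvg)
open T4CubeChartGnomonic (SU2)
open T4Continuum B15DeterminingSets GaugeField
open scoped Matrix.Norms.L2Operator

variable {P : Params}

/-! ## §1  Plumbing: residual gauge transformations do not move the constrained averages; chart∕log identities at `SU(2)` points -/

section Plumbing

/-- A gauge transformation trivial at both endpoints of a bond does not move the bond variable. [cite: Balaban1985Variational, (4) p.278 (bookkeeping)] -/
theorem gaugeAct_apply_eq_of_trivial {j : ℕ} {u : GaugeTransf P j SU2} {W : GaugeField P j SU2} {b : PBond P j}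
    (hs : u b.src = 1) (ht : u b.tgt = 1) : gaugeAct u W b = W b := by
  simp only [GaugeField.gaugeAct, hs, ht, inv_one, one_mul, mul_one]

/-- **THE RESIDUAL GROUP (4) PRESERVES THE FIBRE (3)**: if `u` is trivial on the block towers under the endpoints of the bonds of `𝐁` (levels `≤ k ≤ m + K`, `𝐁` of levels
`≤ k`), then `U^u` has the same averages on `𝐁` as `U` (gauge covariance of the iterated averages, [Balaban1985Averaging] (11), r13's `iter_gaugeAct`). [cite: Balaban1985Variational, (3)–(4) p.278; Balaban1985Averaging, (11) p.19; Balaban1988Convergent, (2.10)–(2.11) p.256] -/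
theorem agreeOn_gaugeAct_of_residual (av : ∀ j, Averaging P j SU2) (𝔹 : DetSet P) {k : ℕ} (hk : k ≤ P.m + P.K)
    (h𝔹 : ∀ j, k < j → 𝔹 j = ∅) {u : GaugeTransf P 0 SU2}
    (hu : ∀ j, j ≤ k → ∀ b ∈ bondsOf (𝔹 j), toMS u j b.src = 1 ∧ toMS u j b.tgt = 1) (U : GaugeField P 0 SU2) :
    AgreeOn 𝔹 (avgFamily av (gaugeAct u U)) (avgFamily av U) := by
  intro j b hb
  by_cases hjk : k < j
  · rw [h𝔹 j hjk] at hb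
    simp [bondsOf] at hb
  have hj : j ≤ k := Nat.le_of_not_lt hjk
  show Averaging.iter av j (gaugeAct u U) b = Averaging.iter av j U b
  rw [iter_gaugeAct av u U j (hj.trans hk)]
  exact gaugeAct_apply_eq_of_trivial (hu j hj b hb).1 (hu j hj b hb).2

/-- The matrix of an `SU(2)` bond variable times the adjoint of another has determinant one. [cite: Balaban1985Variational, p.307 (bookkeeping)] -/
theorem det_coe_mul_star_coe (g h : SU2) :
    (((g : SU2) : Matrix (Fin 2) (Fin 2) ℂ) * star ((h : SU2) : Matrix (Fin 2) (Fin 2) ℂ)).det = 1 := by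
  rw [Matrix.det_mul, Matrix.star_eq_conjTranspose, Matrix.det_conjTranspose, (Matrix.mem_specialUnitaryGroup_iff.1 g.2).2,
    (Matrix.mem_specialUnitaryGroup_iff.1 h.2).2, star_one, one_mul]

/-- **THE SLICE-CHART POINT IN LOGARITHMIC COORDINATES**: if `exp(X)·U₀ = ↑U′` and every `‖Σ_a X(b)_a E_a‖ < ln 2`, then `log(↑U′(b)·↑U₀(b)⋆) = X(b)` (`logCoordC ∘ expPointC = id`
near `0`). [cite: Balaban1985Averaging, (21) p.21; Balaban1985Variational, p.307] -/
theorem logCoordC_coe_mul_star_of_expMulC_eq {U₀ U' : GaugeField P 0 SU2} {X : VecField P 0 (EuclideanSpace ℂ (Fin 3))}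
    (hX : expMulC X (coeField U₀) = coeField U') (hsmall : ∀ b, ‖∑ a : Fin 3, X b a • genE a‖ < Real.log 2) (b : PBond P 0) :
    logCoordC (((U' b : SU2) : Matrix (Fin 2) (Fin 2) ℂ) * star ((U₀ b : SU2) : Matrix (Fin 2) (Fin 2) ℂ)) = X b := by
  have hb : expPointC (X b) * ((U₀ b : SU2) : Matrix (Fin 2) (Fin 2) ℂ) = ((U' b : SU2) : Matrix (Fin 2) (Fin 2) ℂ) := by
    have := congrFun hX b
    simpa [expMulC, coeField] using this
  rw [← hb, mul_assoc, coe_mul_star_coe_SU, mul_one, logCoordC_expPointC _ (hsmall b)]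

/-- **BACK TO THE CHART**: for an `SU(2)` field `V` with `‖↑V(b)·↑U₀(b)⋆ − 1‖ ≤ 1∕3`, `exp(log(↑V(b)·↑U₀(b)⋆))·↑U₀(b) = ↑V(b)` (`expPointC ∘ logCoordC = id` on small `SL₂(ℂ)`).
[cite: Balaban1985Averaging, (21) p.21; Balaban1989LargeFieldII, (1.19) p.360] -/
theorem expPointC_logCoordC_mul_coe {U₀ V : GaugeField P 0 SU2} (b : PBond P 0)
    (h : ‖((V b : SU2) : Matrix (Fin 2) (Fin 2) ℂ) * star ((U₀ b : SU2) : Matrix (Fin 2) (Fin 2) ℂ) - 1‖ ≤ 1 / 3) :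
    expPointC (logCoordC (((V b : SU2) : Matrix (Fin 2) (Fin 2) ℂ) * star ((U₀ b : SU2) : Matrix (Fin 2) (Fin 2) ℂ))) *
      ((U₀ b : SU2) : Matrix (Fin 2) (Fin 2) ℂ) = ((V b : SU2) : Matrix (Fin 2) (Fin 2) ℂ) := by
  rw [expPointC_logCoordC h (det_coe_mul_star_coe _ _), mul_assoc, star_coe_mul_coe_SU, mul_one]

end Plumbing

/-! ## §2  The letter `hπ` from a residual gauge-fixing map -/

section Retraction

/-- ★★★ **THE GAUGE RETRACTION `hπ` FROM A RESIDUAL GAUGE-FIXING MAP.**  Data: a base configuration `U₀`, a base datum `Q₀`, a slice `S`, a determining set `𝐁` of levels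
`≤ k ≤ m + K`, and a gauge-fixing map `σ : U ↦ u(U)` with — (σ1) `σ` is trivial on the slice chart: `σ U′ = 1` whenever `↑U′ = exp(X)·↑U₀`, `X ∈ S`; (σ2) `σ` moves every
configuration into the slice chart in logarithmic coordinates: `b ↦ log(↑(U^{σ U})(b)·↑U₀(b)⋆) ∈ S`; (σ3) `t ↦ ↑((γ t)^{σ(γ t)})` is differentiable at `0` along every curve `γ`
differentiable at `0` as bond matrices; (σ4) RESIDUAL: `σ U` is trivial on the block towers under the endpoints of the bonds of `𝐁` ([15] (4)).  CONCLUSION: the letter `hπ` of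
`B15Prop1CritTransferOfGaugeRetraction.hcritT_curve_of_gaugeRetraction`, verbatim (here it even holds for ALL `w` with `‖Σ_a w.1(b)_a E_a‖ < ln 2` and `‖exp(w.1(b)) − 1‖ < 1∕3`,
in particular eventually near `(0, ↑Q₀)`): the retracted curve is `V t := (γ t)^{σ(γ t)}`, the slice curve its logarithmic chart; ACTION by gauge invariance of (5), FIBRE by gauge
covariance of the averaging killed at the constrained bonds by (σ4). [cite: Balaban1985Variational, (4) p.278, (16)–(18) p.280, Sect. G p.305, p.307; Balaban1985RegularSpaces, (1.19) p.79; Balaban1985Averaging, (11) p.19, (21) p.21; Balaban1988Convergent, (0.2) p.244, (2.10)–(2.11) p.256] -/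
theorem gaugeRetraction_of_gaugeSection (𝔹 : DetSet P) (k : ℕ) (hk : k ≤ P.m + P.K) (h𝔹 : ∀ j, k < j → 𝔹 j = ∅)
    (Q₀ U₀ : GaugeField P 0 SU2) (S : Submodule ℂ (VecField P 0 (EuclideanSpace ℂ (Fin 3))))
    -- DISPLAYED: the residual gauge-fixing map into the slice chart ([6] (1.19) `Ax_k(𝔅_k, U₀)` for the axial slice)
    (σ : GaugeField P 0 SU2 → GaugeTransf P 0 SU2)
    (hσ1 : ∀ (U' : GaugeField P 0 SU2) (X : VecField P 0 (EuclideanSpace ℂ (Fin 3))), X ∈ S → expMulC X (coeField U₀) = coeField U' → σ U' = fun _ => 1)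
    (hσ2 : ∀ U : GaugeField P 0 SU2,
      (fun b => logCoordC (((gaugeAct (σ U) U b : SU2) : Matrix (Fin 2) (Fin 2) ℂ) * star ((U₀ b : SU2) : Matrix (Fin 2) (Fin 2) ℂ))) ∈ S)
    (hσ3 : ∀ γ : ℝ → GaugeField P 0 SU2, DifferentiableAt ℝ (fun (t : ℝ) (b : PBond P 0) => ((γ t b : SU2) : Matrix (Fin 2) (Fin 2) ℂ)) 0 →
      DifferentiableAt ℝ (fun (t : ℝ) (b : PBond P 0) => ((gaugeAct (σ (γ t)) (γ t) b : SU2) : Matrix (Fin 2) (Fin 2) ℂ)) 0)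
    (hσ4 : ∀ (U : GaugeField P 0 SU2) j, j ≤ k → ∀ b ∈ bondsOf (𝔹 j), toMS (σ U) j b.src = 1 ∧ toMS (σ U) j b.tgt = 1) :
    ∀ᶠ w in 𝓝 ((0 : S), coeField Q₀), ∀ U' Q' : GaugeField P 0 SU2,
      expMulC (w.1 : VecField P 0 (EuclideanSpace ℂ (Fin 3))) (coeField U₀) = coeField U' → coeField Q' = w.2 →
        AgreeOn 𝔹 (avgFamily (fun j => blockAvg (P := P) (j := j) expMeanLogSU) U') (avgFamily (fun j => blockAvg (P := P) (j := j) expMeanLogSU) Q') →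
        ∀ γ : ℝ → GaugeField P 0 SU2, γ 0 = U' →
          DifferentiableAt ℝ (fun (t : ℝ) (b : PBond P 0) => ((γ t b : SU2) : Matrix (Fin 2) (Fin 2) ℂ)) 0 →
          (∀ᶠ t in 𝓝 (0 : ℝ), AgreeOn 𝔹 (avgFamily (fun j => blockAvg (P := P) (j := j) expMeanLogSU) (γ t))
            (avgFamily (fun j => blockAvg (P := P) (j := j) expMeanLogSU) Q')) →
          ∃ X : ℝ → S, X 0 = w.1 ∧ DifferentiableAt ℝ X 0 ∧
            ∀ᶠ t in 𝓝 (0 : ℝ), ∃ V : GaugeField P 0 SU2,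
              expMulC (X t : VecField P 0 (EuclideanSpace ℂ (Fin 3))) (coeField U₀) = coeField V ∧
              wilsonAction4 V = wilsonAction4 (γ t) ∧
              AgreeOn 𝔹 (avgFamily (fun j => blockAvg (P := P) (j := j) expMeanLogSU) V) (avgFamily (fun j => blockAvg (P := P) (j := j) expMeanLogSU) Q') := by
  set av : ∀ j, Averaging P j SU2 := fun j => blockAvg (P := P) (j := j) expMeanLogSU with hav
  -- a continuous linear projection onto the slice (finite dimension)
  obtain ⟨S', hSS'⟩ := S.exists_isCompl
  set pr : VecField P 0 (EuclideanSpace ℂ (Fin 3)) →L[ℂ] S := LinearMap.toContinuousLinearMap (S.projectionOnto S' hSS') with hpr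
  have hpr_left : ∀ x : S, pr (x : VecField P 0 (EuclideanSpace ℂ (Fin 3))) = x := fun x =>
    Submodule.projectionOnto_apply_left hSS' x
  -- the two smallness conditions on `w.1`, both open at `0`
  have hlinz : Continuous fun z : EuclideanSpace ℂ (Fin 3) => ∑ a : Fin 3, z a • genE a :=
    (Differentiable.fun_sum fun a _ =>
      ((EuclideanSpace.proj a : EuclideanSpace ℂ (Fin 3) →L[ℂ] ℂ).differentiable).smul_const (genE a)).continuous
  have hlin : ∀ b : PBond P 0, Continuous fun X : S => ∑ a : Fin 3, (X : VecField P 0 (EuclideanSpace ℂ (Fin 3))) b a • genE a := fun b =>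
    hlinz.comp ((continuous_apply b).comp continuous_subtype_val)
  have hsmall1 : ∀ᶠ X : S in 𝓝 (0 : S), ∀ b, ‖∑ a : Fin 3, (X : VecField P 0 (EuclideanSpace ℂ (Fin 3))) b a • genE a‖ < Real.log 2 := by
    refine eventually_all.2 fun b => ?_
    have h0 : ‖∑ a : Fin 3, ((0 : S) : VecField P 0 (EuclideanSpace ℂ (Fin 3))) b a • genE a‖ < Real.log 2 := by
      simp [Real.log_pos (by norm_num : (1 : ℝ) < 2)]
    have hc : Continuous fun X : S => ‖∑ a : Fin 3, (X : VecField P 0 (EuclideanSpace ℂ (Fin 3))) b a • genE a‖ := (hlin b).norm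
    exact (hc.continuousAt (x := 0)).eventually (gt_mem_nhds h0)
  have hexpc : ∀ b : PBond P 0, Continuous fun X : S => expPointC ((X : VecField P 0 (EuclideanSpace ℂ (Fin 3))) b) := fun b =>
    B15SU2ChartHolomorphic.differentiable_expPointC.continuous.comp ((continuous_apply b).comp continuous_subtype_val)
  have hsmall2 : ∀ᶠ X : S in 𝓝 (0 : S), ∀ b, ‖expPointC ((X : VecField P 0 (EuclideanSpace ℂ (Fin 3))) b) - 1‖ < 1 / 3 := by
    refine eventually_all.2 fun b => ?_
    have h0 : ‖expPointC (((0 : S) : VecField P 0 (EuclideanSpace ℂ (Fin 3))) b) - 1‖ < 1 / 3 := by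
      simp [B15Prop1DatumCoordinates.expPointC_zero]
    have hc : Continuous fun X : S => ‖expPointC ((X : VecField P 0 (EuclideanSpace ℂ (Fin 3))) b) - 1‖ :=
      ((hexpc b).sub continuous_const).norm
    exact (hc.continuousAt (x := 0)).eventually (gt_mem_nhds h0)
  have hw : ∀ᶠ w : S × (PBond P 0 → Matrix (Fin 2) (Fin 2) ℂ) in 𝓝 ((0 : S), coeField Q₀),
      (∀ b, ‖∑ a : Fin 3, (w.1 : VecField P 0 (EuclideanSpace ℂ (Fin 3))) b a • genE a‖ < Real.log 2) ∧
      ∀ b, ‖expPointC ((w.1 : VecField P 0 (EuclideanSpace ℂ (Fin 3))) b) - 1‖ < 1 / 3 :=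
    (hsmall1.and hsmall2).prod_inl_nhds (coeField Q₀)
  filter_upwards [hw] with w hw' U' Q' hU' hQ' hagree γ hγ0 hγd hγfib
  obtain ⟨hwlog, hwexp⟩ := hw'
  -- the gauge-fixed curve and its logarithmic chart
  set V : ℝ → GaugeField P 0 SU2 := fun t => gaugeAct (σ (γ t)) (γ t) with hVdef
  set G : ℝ → PBond P 0 → Matrix (Fin 2) (Fin 2) ℂ := fun t b =>
    ((V t b : SU2) : Matrix (Fin 2) (Fin 2) ℂ) * star ((U₀ b : SU2) : Matrix (Fin 2) (Fin 2) ℂ) with hGdef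
  set F : ℝ → VecField P 0 (EuclideanSpace ℂ (Fin 3)) := fun t b => logCoordC (G t b) with hFdef
  have hFmem : ∀ t, F t ∈ S := fun t => hσ2 (γ t)
  set X : ℝ → S := fun t => pr (F t) with hXdef
  have hXF : ∀ t, (X t : VecField P 0 (EuclideanSpace ℂ (Fin 3))) = F t := fun t => by
    have := hpr_left ⟨F t, hFmem t⟩
    exact congrArg Subtype.val this
  -- at `t = 0`: `σ U′ = 1`, `V 0 = U′`, `G 0 b = exp(w.1 b)`, `F 0 = w.1`
  have hσ0 : σ U' = fun _ => 1 := hσ1 U' _ w.1.2 hU'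
  have hV0 : V 0 = U' := by
    show gaugeAct (σ (γ 0)) (γ 0) = U'
    rw [hγ0, hσ0]
    exact B15Prop1Carrier.gaugeAct_one_fun U'
  have hG0 : ∀ b, G 0 b = expPointC ((w.1 : VecField P 0 (EuclideanSpace ℂ (Fin 3))) b) := fun b => by
    show ((V 0 b : SU2) : Matrix (Fin 2) (Fin 2) ℂ) * star ((U₀ b : SU2) : Matrix (Fin 2) (Fin 2) ℂ) = _
    rw [hV0]
    have hb : expPointC ((w.1 : VecField P 0 (EuclideanSpace ℂ (Fin 3))) b) * ((U₀ b : SU2) : Matrix (Fin 2) (Fin 2) ℂ) =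
        ((U' b : SU2) : Matrix (Fin 2) (Fin 2) ℂ) := by
      have := congrFun hU' b
      simpa [expMulC, coeField] using this
    rw [← hb, mul_assoc, coe_mul_star_coe_SU, mul_one]
  have hF0 : F 0 = (w.1 : VecField P 0 (EuclideanSpace ℂ (Fin 3))) := by
    funext b
    show logCoordC (G 0 b) = _
    rw [hG0 b, logCoordC_expPointC _ (hwlog b)]
  refine ⟨X, ?_, ?_, ?_⟩
  · -- `X 0 = w.1`
    apply Subtype.ext
    rw [hXF 0, hF0]
  · -- differentiability of the slice curve at `0`
    have hVd : DifferentiableAt ℝ (fun (t : ℝ) (b : PBond P 0) => ((V t b : SU2) : Matrix (Fin 2) (Fin 2) ℂ)) 0 := hσ3 γ hγd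
    have hGd : ∀ b, DifferentiableAt ℝ (fun t => G t b) 0 := fun b => by
      have h1 : DifferentiableAt ℝ (fun t => ((V t b : SU2) : Matrix (Fin 2) (Fin 2) ℂ)) 0 :=
        (differentiableAt_pi.1 hVd) b
      exact h1.mul_const _
    have hFd : DifferentiableAt ℝ F 0 := by
      refine differentiableAt_pi.2 fun b => ?_
      show DifferentiableAt ℝ (fun t => logCoordC (G t b)) 0
      have hlt : ‖G 0 b - 1‖ < 1 := by rw [hG0 b]; exact (hwexp b).trans (by norm_num)
      have hc := ((differentiableAt_logCoordC hlt).restrictScalars ℝ).comp (0 : ℝ) (hGd b)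
      exact hc
    have hXc := ((pr.restrictScalars ℝ).differentiableAt).comp (0 : ℝ) hFd
    exact hXc
  · -- the retracted fields: chart identity (once `‖G t b − 1‖ ≤ 1∕3`), same action, same averages on `𝐁`
    have hGc : ∀ b, ContinuousAt (fun t => G t b) 0 := fun b => by
      have hVd : DifferentiableAt ℝ (fun (t : ℝ) (b : PBond P 0) => ((V t b : SU2) : Matrix (Fin 2) (Fin 2) ℂ)) 0 := hσ3 γ hγd
      exact (((differentiableAt_pi.1 hVd) b).mul_const _).continuousAt
    have hclose : ∀ᶠ t in 𝓝 (0 : ℝ), ∀ b, ‖G t b - 1‖ < 1 / 3 := by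
      refine eventually_all.2 fun b => ?_
      have h0 : ‖G 0 b - 1‖ < 1 / 3 := by rw [hG0 b]; exact hwexp b
      exact (((hGc b).sub continuousAt_const).norm).eventually (gt_mem_nhds h0)
    filter_upwards [hclose, hγfib] with t ht hfib
    refine ⟨V t, ?_, wilsonAction4_gaugeAct' _ _, ?_⟩
    · funext b
      show expPointC ((X t : VecField P 0 (EuclideanSpace ℂ (Fin 3))) b) * ((U₀ b : SU2) : Matrix (Fin 2) (Fin 2) ℂ) = ((V t b : SU2) : Matrix (Fin 2) (Fin 2) ℂ)
      rw [hXF t]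
      exact expPointC_logCoordC_mul_coe b (ht b).le
    · intro j b hb
      rw [agreeOn_gaugeAct_of_residual av 𝔹 hk h𝔹 (hσ4 (γ t)) (γ t) j b hb]
      exact hfib j b hb

end Retraction

/-! ## §3  The composition: w1's `hcritT` binder from the base-field data and a residual gauge-fixing map -/

section Composition

/-- ★★ **`hcritT` AT CURVE-CRITICALITY FROM A RESIDUAL GAUGE-FIXING MAP** — the composition of `B15Prop1CritTransferOfGaugeRetraction.hcritT_curve_of_gaugeRetraction` with §2:
w1's `hcritT` binder (`exists_localChart_at_baseField` :114–:117) at `Crit Q′ U′ :=` curve-criticality of the Wilson action on the fibre of `avgFamily av Q′`, from the base-field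
data (guards, `U₀` on the base fibre, slice, action and constraint coordinates characterised pointwise) and the four clauses (σ1)–(σ4) of a residual gauge-fixing map — after which the
criticality transfer displays ONLY the gauge-fixing map ([6] (1.19)). [cite: Balaban1985Variational, Thm 1 p.279, (4) p.278, (16)–(18) p.280, Sect. F p.300; Balaban1985RegularSpaces, (1.19) p.79; Balaban1988Convergent, (2.10)–(2.12) p.256] -/
theorem hcritT_curve_of_gaugeSection (𝔹 : DetSet P) (k : ℕ) (hk : k ≤ P.m + P.K) (h𝔹 : ∀ j, k < j → 𝔹 j = ∅) {Q₀ U₀ : GaugeField P 0 SU2}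
    (hsbQ : SmallBelow (fun j => blockAvg (P := P) (j := j) expMeanLogSU) k Q₀)
    (hsbU : SmallBelow (fun j => blockAvg (P := P) (j := j) expMeanLogSU) k U₀)
    (hU₀ : AgreeOn 𝔹 (avgFamily (fun j => blockAvg (P := P) (j := j) expMeanLogSU) U₀) (avgFamily (fun j => blockAvg (P := P) (j := j) expMeanLogSU) Q₀))
    (S : Submodule ℂ (VecField P 0 (EuclideanSpace ℂ (Fin 3))))
    (a : S → ℂ)
    (ha : ∀ X : S, a X = ∑ p : Plaq P 0, (1 - (expMulC (X : VecField P 0 (EuclideanSpace ℂ (Fin 3))) (coeField U₀) ⟨p.src, p.μ⟩ *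
      expMulC (X : VecField P 0 (EuclideanSpace ℂ (Fin 3))) (coeField U₀) ⟨p.src.shift p.μ, p.ν⟩ *
      Matrix.adjugate (expMulC (X : VecField P 0 (EuclideanSpace ℂ (Fin 3))) (coeField U₀) ⟨p.src.shift p.ν, p.μ⟩) *
      Matrix.adjugate (expMulC (X : VecField P 0 (EuclideanSpace ℂ (Fin 3))) (coeField U₀) ⟨p.src, p.ν⟩)).trace / 2))
    (Φ₀ : S → Fin (constrCard 𝔹 k) → EuclideanSpace ℂ (Fin 3))
    (hΦ₀ : ∀ (X : S) i, Φ₀ X i = logCoordC (star ((avgFamily (fun j => blockAvg (P := P) (j := j) expMeanLogSU) Q₀ ((constrEnum 𝔹 k).symm i).1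
      ((constrEnum 𝔹 k).symm i).2.1 : SU2) : Matrix (Fin 2) (Fin 2) ℂ) *
      iterMh ((constrEnum 𝔹 k).symm i).1 (expMulC (X : VecField P 0 (EuclideanSpace ℂ (Fin 3))) (coeField U₀)) ((constrEnum 𝔹 k).symm i).2.1))
    -- DISPLAYED: the residual gauge-fixing map (σ1)–(σ4)
    (σ : GaugeField P 0 SU2 → GaugeTransf P 0 SU2)
    (hσ1 : ∀ (U' : GaugeField P 0 SU2) (X : VecField P 0 (EuclideanSpace ℂ (Fin 3))), X ∈ S → expMulC X (coeField U₀) = coeField U' → σ U' = fun _ => 1)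
    (hσ2 : ∀ U : GaugeField P 0 SU2,
      (fun b => logCoordC (((gaugeAct (σ U) U b : SU2) : Matrix (Fin 2) (Fin 2) ℂ) * star ((U₀ b : SU2) : Matrix (Fin 2) (Fin 2) ℂ))) ∈ S)
    (hσ3 : ∀ γ : ℝ → GaugeField P 0 SU2, DifferentiableAt ℝ (fun (t : ℝ) (b : PBond P 0) => ((γ t b : SU2) : Matrix (Fin 2) (Fin 2) ℂ)) 0 →
      DifferentiableAt ℝ (fun (t : ℝ) (b : PBond P 0) => ((gaugeAct (σ (γ t)) (γ t) b : SU2) : Matrix (Fin 2) (Fin 2) ℂ)) 0)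
    (hσ4 : ∀ (U : GaugeField P 0 SU2) j, j ≤ k → ∀ b ∈ bondsOf (𝔹 j), toMS (σ U) j b.src = 1 ∧ toMS (σ U) j b.tgt = 1) :
    ∀ᶠ w in 𝓝 ((0 : S), coeField Q₀), ∀ (U' Q' : GaugeField P 0 SU2) (μ : (Fin (constrCard 𝔹 k) → EuclideanSpace ℂ (Fin 3)) →L[ℂ] ℂ),
      expMulC (w.1 : VecField P 0 (EuclideanSpace ℂ (Fin 3))) (coeField U₀) = coeField U' → coeField Q' = w.2 →
        AgreeOn 𝔹 (avgFamily (fun j => blockAvg (P := P) (j := j) expMeanLogSU) U') (avgFamily (fun j => blockAvg (P := P) (j := j) expMeanLogSU) Q') →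
        fderiv ℂ a w.1 = μ.comp (fderiv ℂ Φ₀ w.1) →
          ∀ γ : ℝ → GaugeField P 0 SU2, γ 0 = U' →
            DifferentiableAt ℝ (fun (t : ℝ) (b : PBond P 0) => ((γ t b : SU2) : Matrix (Fin 2) (Fin 2) ℂ)) 0 →
            (∀ᶠ t in 𝓝 (0 : ℝ), AgreeOn 𝔹 (avgFamily (fun j => blockAvg (P := P) (j := j) expMeanLogSU) (γ t))
              (avgFamily (fun j => blockAvg (P := P) (j := j) expMeanLogSU) Q')) →
            ∀ d : ℝ, HasDerivAt (fun t => wilsonAction4 (γ t)) d 0 → d = 0 :=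
  hcritT_curve_of_gaugeRetraction 𝔹 k hsbQ hsbU hU₀ S a ha Φ₀ hΦ₀ (gaugeRetraction_of_gaugeSection 𝔹 k hk h𝔹 Q₀ U₀ S σ hσ1 hσ2 hσ3 hσ4)

variable {F : T4Family}

/-- ★★ **THE RECORD TWIN**: on the torus `F.P Kt` of the family (averaging of record `avOfRecord F 2 Kt`, `rfl`), n07-e's `Node00.IsCritOnFibre F 2 Kt 𝐁 (avgFamily (avOfRecord F 2 Kt) Q′) U′`
for the chart points near the base datum that are Lagrange-critical on the slice, from the base-field data and a residual gauge-fixing map (σ1)–(σ4).  Applies verbatim to N12's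
`𝐁 := Bj ν.M₁ Z k`. [cite: Balaban1985Variational, Thm 1 p.279, (16)–(18) p.280, Prop. 8 p.304; Balaban1988Convergent, (2.10)–(2.13) pp.256–257; Balaban1989LargeFieldI, Prop. 1 p.194] -/
theorem hcritT_isCritOnFibre_of_gaugeSection (Kt : ℕ) (𝔹 : DetSet (F.P Kt)) (k : ℕ) (hk : k ≤ (F.P Kt).m + (F.P Kt).K) (h𝔹 : ∀ j, k < j → 𝔹 j = ∅)
    {Q₀ U₀ : GaugeField (F.P Kt) 0 SU2}
    (hsbQ : SmallBelow (fun j => blockAvg (P := F.P Kt) (j := j) expMeanLogSU) k Q₀)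
    (hsbU : SmallBelow (fun j => blockAvg (P := F.P Kt) (j := j) expMeanLogSU) k U₀)
    (hU₀ : AgreeOn 𝔹 (avgFamily (fun j => blockAvg (P := F.P Kt) (j := j) expMeanLogSU) U₀) (avgFamily (fun j => blockAvg (P := F.P Kt) (j := j) expMeanLogSU) Q₀))
    (S : Submodule ℂ (VecField (F.P Kt) 0 (EuclideanSpace ℂ (Fin 3))))
    (a : S → ℂ)
    (ha : ∀ X : S, a X = ∑ p : Plaq (F.P Kt) 0, (1 - (expMulC (X : VecField (F.P Kt) 0 (EuclideanSpace ℂ (Fin 3))) (coeField U₀) ⟨p.src, p.μ⟩ *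
      expMulC (X : VecField (F.P Kt) 0 (EuclideanSpace ℂ (Fin 3))) (coeField U₀) ⟨p.src.shift p.μ, p.ν⟩ *
      Matrix.adjugate (expMulC (X : VecField (F.P Kt) 0 (EuclideanSpace ℂ (Fin 3))) (coeField U₀) ⟨p.src.shift p.ν, p.μ⟩) *
      Matrix.adjugate (expMulC (X : VecField (F.P Kt) 0 (EuclideanSpace ℂ (Fin 3))) (coeField U₀) ⟨p.src, p.ν⟩)).trace / 2))
    (Φ₀ : S → Fin (constrCard 𝔹 k) → EuclideanSpace ℂ (Fin 3))
    (hΦ₀ : ∀ (X : S) i, Φ₀ X i = logCoordC (star ((avgFamily (fun j => blockAvg (P := F.P Kt) (j := j) expMeanLogSU) Q₀ ((constrEnum 𝔹 k).symm i).1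
      ((constrEnum 𝔹 k).symm i).2.1 : SU2) : Matrix (Fin 2) (Fin 2) ℂ) *
      iterMh ((constrEnum 𝔹 k).symm i).1 (expMulC (X : VecField (F.P Kt) 0 (EuclideanSpace ℂ (Fin 3))) (coeField U₀)) ((constrEnum 𝔹 k).symm i).2.1))
    (σ : GaugeField (F.P Kt) 0 SU2 → GaugeTransf (F.P Kt) 0 SU2)
    (hσ1 : ∀ (U' : GaugeField (F.P Kt) 0 SU2) (X : VecField (F.P Kt) 0 (EuclideanSpace ℂ (Fin 3))), X ∈ S → expMulC X (coeField U₀) = coeField U' → σ U' = fun _ => 1)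
    (hσ2 : ∀ U : GaugeField (F.P Kt) 0 SU2,
      (fun b => logCoordC (((gaugeAct (σ U) U b : SU2) : Matrix (Fin 2) (Fin 2) ℂ) * star ((U₀ b : SU2) : Matrix (Fin 2) (Fin 2) ℂ))) ∈ S)
    (hσ3 : ∀ γ : ℝ → GaugeField (F.P Kt) 0 SU2, DifferentiableAt ℝ (fun (t : ℝ) (b : PBond (F.P Kt) 0) => ((γ t b : SU2) : Matrix (Fin 2) (Fin 2) ℂ)) 0 →
      DifferentiableAt ℝ (fun (t : ℝ) (b : PBond (F.P Kt) 0) => ((gaugeAct (σ (γ t)) (γ t) b : SU2) : Matrix (Fin 2) (Fin 2) ℂ)) 0)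
    (hσ4 : ∀ (U : GaugeField (F.P Kt) 0 SU2) j, j ≤ k → ∀ b ∈ bondsOf (𝔹 j), toMS (σ U) j b.src = 1 ∧ toMS (σ U) j b.tgt = 1) :
    ∀ᶠ w in 𝓝 ((0 : S), coeField Q₀), ∀ (U' Q' : GaugeField (F.P Kt) 0 SU2) (μ : (Fin (constrCard 𝔹 k) → EuclideanSpace ℂ (Fin 3)) →L[ℂ] ℂ),
      expMulC (w.1 : VecField (F.P Kt) 0 (EuclideanSpace ℂ (Fin 3))) (coeField U₀) = coeField U' → coeField Q' = w.2 →
        AgreeOn 𝔹 (avgFamily (fun j => blockAvg (P := F.P Kt) (j := j) expMeanLogSU) U') (avgFamily (fun j => blockAvg (P := F.P Kt) (j := j) expMeanLogSU) Q') →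
        fderiv ℂ a w.1 = μ.comp (fderiv ℂ Φ₀ w.1) →
          IsCritOnFibre F 2 Kt 𝔹 (avgFamily (avOfRecord F 2 Kt) Q') U' :=
  hcritT_isCritOnFibre_of_gaugeRetraction Kt 𝔹 k hsbQ hsbU hU₀ S a ha Φ₀ hΦ₀ (gaugeRetraction_of_gaugeSection 𝔹 k hk h𝔹 Q₀ U₀ S σ hσ1 hσ2 hσ3 hσ4)

end Composition

/-! ## §4  Non-vacuity: at the full slice the trivial gauge is a residual gauge-fixing map -/

section Top

/-- ★ **NON-VACUITY OF `hπ` (A6 rule)**: at the FULL slice `S = ⊤` the trivial gauge `σ := 1` satisfies (σ1)–(σ4), so the gauge-retraction letter `hπ` of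
`B15Prop1CritTransferOfGaugeRetraction.hcritT_curve_of_gaugeRetraction` HOLDS OUTRIGHT there (retract nothing; the slice curve is the logarithmic chart of `γ t · U₀⁻¹`).  The degenerate
witness only: on `⊤` the companion letter (β) of the chart fails (gauge degeneracy); the honest instance is the axial gauge of [6] (1.19). [cite: Balaban1985Variational, (16)–(18) p.280; Balaban1985RegularSpaces, (1.19) p.79; Balaban1985Averaging, (21) p.21] -/
theorem gaugeRetraction_top (𝔹 : DetSet P) (k : ℕ) (hk : k ≤ P.m + P.K) (h𝔹 : ∀ j, k < j → 𝔹 j = ∅) (Q₀ U₀ : GaugeField P 0 SU2) :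
    ∀ᶠ w in 𝓝 ((0 : (⊤ : Submodule ℂ (VecField P 0 (EuclideanSpace ℂ (Fin 3))))), coeField Q₀), ∀ U' Q' : GaugeField P 0 SU2,
      expMulC (w.1 : VecField P 0 (EuclideanSpace ℂ (Fin 3))) (coeField U₀) = coeField U' → coeField Q' = w.2 →
        AgreeOn 𝔹 (avgFamily (fun j => blockAvg (P := P) (j := j) expMeanLogSU) U') (avgFamily (fun j => blockAvg (P := P) (j := j) expMeanLogSU) Q') →
        ∀ γ : ℝ → GaugeField P 0 SU2, γ 0 = U' →
          DifferentiableAt ℝ (fun (t : ℝ) (b : PBond P 0) => ((γ t b : SU2) : Matrix (Fin 2) (Fin 2) ℂ)) 0 →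
          (∀ᶠ t in 𝓝 (0 : ℝ), AgreeOn 𝔹 (avgFamily (fun j => blockAvg (P := P) (j := j) expMeanLogSU) (γ t))
            (avgFamily (fun j => blockAvg (P := P) (j := j) expMeanLogSU) Q')) →
          ∃ X : ℝ → (⊤ : Submodule ℂ (VecField P 0 (EuclideanSpace ℂ (Fin 3)))), X 0 = w.1 ∧ DifferentiableAt ℝ X 0 ∧
            ∀ᶠ t in 𝓝 (0 : ℝ), ∃ V : GaugeField P 0 SU2,
              expMulC (X t : VecField P 0 (EuclideanSpace ℂ (Fin 3))) (coeField U₀) = coeField V ∧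
              wilsonAction4 V = wilsonAction4 (γ t) ∧
              AgreeOn 𝔹 (avgFamily (fun j => blockAvg (P := P) (j := j) expMeanLogSU) V) (avgFamily (fun j => blockAvg (P := P) (j := j) expMeanLogSU) Q') := by
  refine gaugeRetraction_of_gaugeSection 𝔹 k hk h𝔹 Q₀ U₀ ⊤ (fun _ _ => 1) (fun _ _ _ _ => rfl) (fun _ => Submodule.mem_top) (fun γ hγ => ?_)
    (fun _ _ _ _ _ => ⟨rfl, rfl⟩)
  simpa only [B15Prop1Carrier.gaugeAct_one_fun] using hγ

end Top

end Literature.MathematicalPhysics.QuantumFieldTheory.Balaban1983to89.B15Prop1GaugeRetractionOfGaugeSection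

end
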